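import Mathlib
import Summits.AtomisticToContinuum.Crystallization.Theorems.NashClassCertificatesNashNearFieldStubLocalSmoothCertificateOfCauchyBorn
import Summits.AtomisticToContinuum.Crystallization.Theorems.NashClassCertificatesNashNearFieldStubLocalSmoothCertificateOfSitewiseExact
import Summits.AtomisticToContinuum.Crystallization.Theorems.NashClassCertificatesNashNearFieldStubLocalSmoothCertificateOfSitewise

/-!
# Route `NashClassCertificates`, crux `NashNearField` (stmt-AtomisticToContinuum-16827), line `birth`:
# pieces for the stub `stub_fluxOfSitewise` (SITEWISE ⇒ FLUX, the min-cut form of the smooth-regime certificate), I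

FLUX asks, for every sub-collection `S` of radius-8 interior sites of a smooth-regime cluster `Ω`,
`κ r²·#(S ∩ FamFar_r) − C_R Σ_{i∈S} ν_i² ≤ Σ_{i∈S} X_i + M·Σ_{i∈S} Σ_{j∈Ω∖S} |x i − x j|⁻⁶` (`X_i` the calibrated partial
site excess).  Being SUMMED over `S`, its proof needs no transfer: the first-order terms of the sitewise Cauchy–Born
expansion are regrouped over `S`, and only the bonds crossing the cut `S | Ω∖S` and the force imbalance of the
reference INSIDE `S` survive.  This file lands that regrouping and the two exactly solvable cases:

* `stub_cutFirstOrderIdentity` — for an odd bond map `k`, a reference `y`, a displacement `u` and `S ⊆ Ω`: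
  `Σ_{i∈S} ½Σ_{j∈Ω∖i} ⟪k(y i − y j), u i − u j⟫ = Σ_{i∈S} ⟪F^S_i, u i⟫ + ½ Σ_{i∈S} Σ_{j∈Ω∖S} ⟪k(y i − y j), u i − u j⟫`,
  `F^S_i = Σ_{j∈S∖i} k(y i − y j)` (EXACT: inside `S` the pair terms regroup into the work of the reference bond forces
  restricted to `S`; the cut terms stay as they are);
* `stub_cutSiteExpansion` — with the Lennard-Jones bond gradient and `x = y + u` dominated by the reference on `Ω`:
  `Σ_{i∈S} e_i(x) ≥ Σ_{i∈S} e_i(y) + Σ_{i∈S} ⟪F^S_i, u i⟫ + ½ Σ_{i∈S}Σ_{j∈Ω∖S} ⟪k_ij, u i − u j⟫ − Σ_{i∈S} Rem_i`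
  (`Rem_i` the landed one-bond Taylor remainders summed over `Ω ∖ i`) — the summed sitewise Cauchy–Born expansion over
  a cut: with a bounded gauge the cut term is `≤ 2ν Σ_cut (d⁻¹³ + d⁻⁷)`, i.e. cut capacity, and ALL the remaining
  difficulty of FLUX is `Σ_{i∈S} ⟪F^S_i, u i⟫` (force imbalance of the truncated reference: full-lattice force balance,
  missing-site shadowing by the collar, gauge changes between charts);
* `stub_fluxAffineExact` — the `ν = 0` case of FLUX for an arbitrary cut: if `Ω` is an exact piece of one strained
  stacking, the landed `stub_lscAffineExact` transfer summed over `S` gives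
  `E·#S ≤ Σ_{i∈S} X_i + 3 C_w Σ_{i∈S} Σ_{j∈Ω∖S} |x i − x j|⁻⁶` at every `S` whose sites have occupied image-8-balls
  (internal layer fluxes cancel, the cut carries at most its capacity);
* `stub_fluxSingleChart` — the SINGLE-CHART case with a bounded gauge `u = x − y`, `‖u‖ ≤ ν ≤ 1/50`: FLUX holds
  over every cut up to the work `Σ_{i∈S} ⟪F^Ω_i, u i⟫` of the truncated reference's bond forces against the gauge,
  all other terms being cut capacity (`3 C_w d⁻⁶ + 2ν (d⁻¹³ + d⁻⁷)`) or `2ν² ×` lattice constants — isolating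
  truncation/residual forces and, beyond one chart, the gauge change as the remaining content of FLUX.

All `[folklore]`; `e_i(z) = ½ Σ_{j∈Ω∖i} V_LJ(‖z i − z j‖)`.
-/

noncomputable section

open scoped BigOperators RealInnerProductSpace
open Literature.MathematicalPhysics.StatisticalMechanics

namespace Summit.AtomisticToContinuum.Crystallization.Theorems.NashClassCertificatesNashNearField

/-- **Stub piece `stub_cutFirstOrderIdentity`: first-order terms regrouped over a cut (proved).**  For an odd bond
map `k`, `S ⊆ Ω`, a reference `y` and a displacement `u`:
`Σ_{i∈S} ½ Σ_{j∈Ω∖i} ⟪k(y i − y j), u i − u j⟫ = Σ_{i∈S} ⟪Σ_{j∈S∖i} k(y i − y j), u i⟫ + ½ Σ_{i∈S} Σ_{j∈Ω∖S} ⟪k(y i − y j), u i − u j⟫`.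
Inside `S` the ordered pairs `(i,j)` and `(j,i)` combine (`k` odd) into the work of the bond force against `u i`; the
bonds crossing the cut are kept. [folklore] -/
theorem stub_cutFirstOrderIdentity :
    ∀ (N : ℕ) (k : EuclideanSpace ℝ (Fin 3) → EuclideanSpace ℝ (Fin 3)), (∀ v, k (-v) = -k v) →
      ∀ (Ω S : Finset (Fin N)) (y u : Fin N → EuclideanSpace ℝ (Fin 3)), S ⊆ Ω →
        ∑ i ∈ S, (1 / 2 : ℝ) * (∑ j ∈ Ω.erase i, inner ℝ (k (y i - y j)) (u i - u j)) =
          (∑ i ∈ S, inner ℝ (∑ j ∈ S.erase i, k (y i - y j)) (u i)) +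
            (1 / 2 : ℝ) * ∑ i ∈ S, ∑ j ∈ Ω \ S, inner ℝ (k (y i - y j)) (u i - u j) := by
  intro N k hk Ω S y u hS
  classical
  have hk0 : k 0 = 0 := odd_apply_zero hk
  -- split `Ω ∖ i = (S ∖ i) ∪ (Ω ∖ S)` for `i ∈ S`
  have hsplit : ∀ i ∈ S, ∀ f : Fin N → ℝ,
      ∑ j ∈ Ω.erase i, f j = ∑ j ∈ S.erase i, f j + ∑ j ∈ Ω \ S, f j := by
    intro i hi f
    have hunion : Ω.erase i = S.erase i ∪ Ω \ S := by
      ext j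
      simp only [Finset.mem_erase, Finset.mem_union, Finset.mem_sdiff]
      constructor
      · rintro ⟨hji, hjΩ⟩
        by_cases hjS : j ∈ S
        · exact Or.inl ⟨hji, hjS⟩
        · exact Or.inr ⟨hjΩ, hjS⟩
      · rintro (⟨hji, hjS⟩ | ⟨hjΩ, hjS⟩)
        · exact ⟨hji, hS hjS⟩
        · exact ⟨fun h => hjS (h ▸ hi), hjΩ⟩
    have hdisj : Disjoint (S.erase i) (Ω \ S) := by
      rw [Finset.disjoint_left]
      intro j hj hj'
      exact (Finset.mem_sdiff.1 hj').2 (Finset.mem_of_mem_erase hj)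
    rw [hunion, Finset.sum_union hdisj]
  -- the left side, split
  have hL : ∑ i ∈ S, (1 / 2 : ℝ) * (∑ j ∈ Ω.erase i, inner ℝ (k (y i - y j)) (u i - u j)) =
      (1 / 2 : ℝ) * (∑ i ∈ S, ∑ j ∈ S.erase i, inner ℝ (k (y i - y j)) (u i - u j)) +
        (1 / 2 : ℝ) * ∑ i ∈ S, ∑ j ∈ Ω \ S, inner ℝ (k (y i - y j)) (u i - u j) := by
    rw [Finset.mul_sum, Finset.mul_sum, ← Finset.sum_add_distrib]
    refine Finset.sum_congr rfl fun i hi => ?_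
    rw [hsplit i hi, mul_add]
  rw [hL, add_left_inj]
  -- inside `S`: drop the (vanishing) diagonal, symmetrise
  have hdiag : ∀ g : Fin N → Fin N → ℝ, (∀ i, g i i = 0) →
      ∑ i ∈ S, ∑ j ∈ S.erase i, g i j = ∑ i ∈ S, ∑ j ∈ S, g i j := by
    intro g hg
    refine Finset.sum_congr rfl fun i hi => ?_
    rw [← Finset.add_sum_erase S (g i) hi, hg i, zero_add]
  have e1 : ∑ i ∈ S, ∑ j ∈ S.erase i, inner ℝ (k (y i - y j)) (u i - u j) =
      ∑ i ∈ S, ∑ j ∈ S, inner ℝ (k (y i - y j)) (u i - u j) :=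
    hdiag _ fun i => by rw [sub_self, hk0, inner_zero_left]
  have e2 : ∑ i ∈ S, inner ℝ (∑ j ∈ S.erase i, k (y i - y j)) (u i) =
      ∑ i ∈ S, ∑ j ∈ S, inner ℝ (k (y i - y j)) (u i) := by
    rw [← hdiag (fun i j => inner ℝ (k (y i - y j)) (u i)) fun i => by
      show inner ℝ (k (y i - y i)) (u i) = 0
      rw [sub_self, hk0, inner_zero_left]]
    refine Finset.sum_congr rfl fun i _ => ?_
    rw [sum_inner]
  rw [e1, e2]
  -- `⟪k_ij, u_i − u_j⟫ = ⟪k_ij, u_i⟫ − ⟪k_ij, u_j⟫` and the second double sum is minus the first after swapping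
  have e3 : ∑ i ∈ S, ∑ j ∈ S, inner ℝ (k (y i - y j)) (u i - u j) =
      (∑ i ∈ S, ∑ j ∈ S, inner ℝ (k (y i - y j)) (u i)) - ∑ i ∈ S, ∑ j ∈ S, inner ℝ (k (y i - y j)) (u j) := by
    rw [← Finset.sum_sub_distrib]
    refine Finset.sum_congr rfl fun i _ => ?_
    rw [← Finset.sum_sub_distrib]
    refine Finset.sum_congr rfl fun j _ => ?_
    rw [inner_sub_right]
  have e4 : ∑ i ∈ S, ∑ j ∈ S, inner ℝ (k (y i - y j)) (u j) =
      -∑ i ∈ S, ∑ j ∈ S, inner ℝ (k (y i - y j)) (u i) := by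
    rw [Finset.sum_comm, ← Finset.sum_neg_distrib]
    refine Finset.sum_congr rfl fun i _ => ?_
    rw [← Finset.sum_neg_distrib]
    refine Finset.sum_congr rfl fun j _ => ?_
    rw [show y j - y i = -(y i - y j) by abel, hk, inner_neg_left]
  rw [e3, e4]
  ring

/-- **Stub piece `stub_cutSiteExpansion`: the summed sitewise Cauchy–Born expansion over a cut (proved).**  With the
Lennard-Jones bond gradient `k(v) = (−‖v‖⁻¹⁴ + ‖v‖⁻⁸)·v`, an actual configuration `x = y + u` and `S ⊆ Ω` such that
every reference bond from a site of `S` dominates its displacement (`‖u i − u j‖ ≤ ‖y i − y j‖/4`, `y j ≠ y i` on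
`Ω ∖ i`): `Σ_{i∈S} e_i(x) ≥ Σ_{i∈S} e_i(y) + Σ_{i∈S} ⟪F^S_i, u i⟫ + ½ Σ_{i∈S} Σ_{j∈Ω∖S} ⟪k_ij, u i − u j⟫ − Σ_{i∈S} Rem_i`,
`F^S_i = Σ_{j∈S∖i} k(y i − y j)`, `Rem_i = ½ Σ_{j∈Ω∖i} ‖u i − u j‖² (7281 ‖y i − y j‖⁻¹⁴ + 521 ‖y i − y j‖⁻⁸)`
(`stub_siteExpansionRemainder` summed, `stub_cutFirstOrderIdentity`). [folklore] -/
theorem stub_cutSiteExpansion :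
    ∀ (N : ℕ) (Ω S : Finset (Fin N)) (x y u : Fin N → EuclideanSpace ℝ (Fin 3)), S ⊆ Ω →
      (∀ j : Fin N, x j = y j + u j) →
      (∀ i ∈ S, ∀ j ∈ Ω.erase i, y i - y j ≠ 0 ∧ ‖u i - u j‖ ≤ ‖y i - y j‖ / 4) →
        (∑ i ∈ S, (1 / 2 : ℝ) * (∑ j ∈ Ω.erase i, lennardJones ‖y i - y j‖)) +
            (∑ i ∈ S, inner ℝ (∑ j ∈ S.erase i,
              (-((‖y i - y j‖ ^ 2)⁻¹) ^ 7 + ((‖y i - y j‖ ^ 2)⁻¹) ^ 4) • (y i - y j)) (u i)) +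
            (1 / 2 : ℝ) * (∑ i ∈ S, ∑ j ∈ Ω \ S,
              inner ℝ ((-((‖y i - y j‖ ^ 2)⁻¹) ^ 7 + ((‖y i - y j‖ ^ 2)⁻¹) ^ 4) • (y i - y j)) (u i - u j)) -
            (∑ i ∈ S, (1 / 2 : ℝ) * (∑ j ∈ Ω.erase i,
              ‖u i - u j‖ ^ 2 * (7281 * ((‖y i - y j‖ ^ 2)⁻¹) ^ 7 + 521 * ((‖y i - y j‖ ^ 2)⁻¹) ^ 4))) ≤
          ∑ i ∈ S, (1 / 2 : ℝ) * (∑ j ∈ Ω.erase i, lennardJones ‖x i - x j‖) := by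
  intro N Ω S x y u hS hx hdom
  have hk : ∀ v : EuclideanSpace ℝ (Fin 3),
      (fun v : EuclideanSpace ℝ (Fin 3) => (-((‖v‖ ^ 2)⁻¹) ^ 7 + ((‖v‖ ^ 2)⁻¹) ^ 4) • v) (-v) =
        -(fun v : EuclideanSpace ℝ (Fin 3) => (-((‖v‖ ^ 2)⁻¹) ^ 7 + ((‖v‖ ^ 2)⁻¹) ^ 4) • v) v := by
    intro v
    simp only [norm_neg, smul_neg]
  have hid := stub_cutFirstOrderIdentity N
    (fun v : EuclideanSpace ℝ (Fin 3) => (-((‖v‖ ^ 2)⁻¹) ^ 7 + ((‖v‖ ^ 2)⁻¹) ^ 4) • v) hk Ω S y u hS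
  -- the sitewise remainders, summed over `S`
  have hrem : ∀ i ∈ S,
      (1 / 2 : ℝ) * (∑ j ∈ Ω.erase i, lennardJones ‖y i - y j‖) +
          (1 / 2 : ℝ) * (∑ j ∈ Ω.erase i,
            inner ℝ ((-((‖y i - y j‖ ^ 2)⁻¹) ^ 7 + ((‖y i - y j‖ ^ 2)⁻¹) ^ 4) • (y i - y j)) (u i - u j)) -
          (1 / 2 : ℝ) * (∑ j ∈ Ω.erase i,
            ‖u i - u j‖ ^ 2 * (7281 * ((‖y i - y j‖ ^ 2)⁻¹) ^ 7 + 521 * ((‖y i - y j‖ ^ 2)⁻¹) ^ 4)) ≤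
        (1 / 2 : ℝ) * (∑ j ∈ Ω.erase i, lennardJones ‖x i - x j‖) := by
    intro i hi
    have h := (abs_le.1 (stub_siteExpansionRemainder N Ω x y u i hx (hdom i hi))).1
    linarith
  have hsum := Finset.sum_le_sum hrem
  rw [Finset.sum_sub_distrib, Finset.sum_add_distrib, hid] at hsum
  linarith

/-- **Stub piece `stub_fluxAffineExact`: FLUX in the affine-exact case, for an arbitrary cut (proved).**  In the
setting of `stub_lscAffineExact` (the cluster `Ω` an exact piece of one strained stacking with injective labels, the
sitewise landscape bound for `(s, G)` at level `E` with corrector `|w| ≤ C_w`, summable strained site series), for every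
`S ⊆ Ω` all of whose sites have occupied image-8-balls:
`E·#S ≤ Σ_{i∈S} ½Σ_{j∈Ω∖i} V(|x i − x j|) + 3 C_w Σ_{i∈S} Σ_{j∈Ω∖S} |x i − x j|⁻⁶` — the summed certificate with zero
residual: the single-partner layer fluxes cancel inside `S` and cross the cut with at most its capacity. [folklore] -/
theorem stub_fluxAffineExact :
    ∀ (N : ℕ) (x : Fin N → EuclideanSpace ℝ (Fin 3)) (Ω : Finset (Fin N)) (x₀ : EuclideanSpace ℝ (Fin 3))
      (s : ℤ → ℤ) (G : EuclideanSpace ℝ (Fin 3) →L[ℝ] EuclideanSpace ℝ (Fin 3)) (σ : Fin N → ℤ × ℤ × ℤ)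
      (w : ℤ → ℝ) (Cw E : ℝ),
      IsHaggSeq s → (∀ v : EuclideanSpace ℝ (Fin 3), 4 / 5 * ‖v‖ ≤ ‖G v‖ ∧ ‖G v‖ ≤ 6 / 5 * ‖v‖) →
      (∀ j ∈ Ω, x j = x₀ + G (barlowPos 1 (Real.sqrt 6 / 3) s (σ j).1 (σ j).2.1 (σ j).2.2)) → Set.InjOn σ ↑Ω →
      (∀ n : ℤ, |w n| ≤ Cw) →
      (∀ m : ℤ, E ≤ (1 / 2 : ℝ) * (∑' q : {q : ℤ × ℤ × ℤ // q ≠ (m, 0, 0)},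
          lennardJones ‖G (barlowPos 1 (Real.sqrt 6 / 3) s q.1.1 q.1.2.1 q.1.2.2 -
            barlowPos 1 (Real.sqrt 6 / 3) s m 0 0)‖) + w (m - 1) - w m) →
      (∀ q₀ : ℤ × ℤ × ℤ, Summable fun q : {q : ℤ × ℤ × ℤ // q ≠ q₀} =>
          lennardJones ‖G (barlowPos 1 (Real.sqrt 6 / 3) s q.1.1 q.1.2.1 q.1.2.2 -
            barlowPos 1 (Real.sqrt 6 / 3) s q₀.1 q₀.2.1 q₀.2.2)‖) →
      ∀ S : Finset (Fin N), S ⊆ Ω →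
        (∀ i ∈ S, ∀ q : ℤ × ℤ × ℤ, ‖G (barlowPos 1 (Real.sqrt 6 / 3) s q.1 q.2.1 q.2.2 -
            barlowPos 1 (Real.sqrt 6 / 3) s (σ i).1 (σ i).2.1 (σ i).2.2)‖ ≤ 8 → ∃ j ∈ Ω, σ j = q) →
        E * (S.card : ℝ) ≤
          (∑ i ∈ S, (1 / 2 : ℝ) * (∑ j ∈ Ω.erase i, lennardJones (dist (x i) (x j)))) +
            3 * Cw * (∑ i ∈ S, ∑ j ∈ Ω \ S, (dist (x i) (x j))⁻¹ ^ 6) := by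
  intro N x Ω x₀ s G σ w Cw E hs hG hx hσ hw hSW hsum S hS hhit
  classical
  obtain ⟨τ, hτ, hτM, hcert⟩ := stub_lscAffineExact N x Ω x₀ s G σ w Cw E hs hG hx hσ hw hSW hsum
  -- the pointwise certificate, summed over `S`
  have hpt : ∀ i ∈ S, E ≤ (1 / 2 : ℝ) * (∑ j ∈ Ω.erase i, lennardJones (dist (x i) (x j))) + ∑ j ∈ Ω, τ i j :=
    fun i hi => hcert i (hS hi) (hhit i hi)
  have h1 : ∑ i ∈ S, E ≤ ∑ i ∈ S, ((1 / 2 : ℝ) * (∑ j ∈ Ω.erase i, lennardJones (dist (x i) (x j))) + ∑ j ∈ Ω, τ i j) :=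
    Finset.sum_le_sum hpt
  rw [Finset.sum_const, nsmul_eq_mul, mul_comm] at h1
  rw [Finset.sum_add_distrib] at h1
  -- split the transfer sum: internal part cancels, the cut part is bounded by the capacity
  have hΩsplit : ∀ i, ∑ j ∈ Ω, τ i j = ∑ j ∈ S, τ i j + ∑ j ∈ Ω \ S, τ i j := by
    intro i
    rw [← Finset.sum_union Finset.disjoint_sdiff, Finset.union_sdiff_of_subset hS]
  have hanti : ∑ i ∈ S, ∑ j ∈ S, τ i j = 0 := by
    have h := Finset.sum_comm (s := S) (t := S) (f := τ)
    have h2 : ∑ j ∈ S, ∑ i ∈ S, τ i j = -∑ j ∈ S, ∑ i ∈ S, τ j i := by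
      rw [← Finset.sum_neg_distrib]
      refine Finset.sum_congr rfl fun j _ => ?_
      rw [← Finset.sum_neg_distrib]
      exact Finset.sum_congr rfl fun i _ => hτ i j
    linarith
  have hcut : ∑ i ∈ S, ∑ j ∈ Ω \ S, τ i j ≤ 3 * Cw * ∑ i ∈ S, ∑ j ∈ Ω \ S, (dist (x i) (x j))⁻¹ ^ 6 := by
    rw [Finset.mul_sum]
    refine Finset.sum_le_sum fun i _ => ?_
    rw [Finset.mul_sum]
    refine Finset.sum_le_sum fun j _ => ?_
    exact (le_abs_self _).trans (hτM i j)
  have hτsum : ∑ i ∈ S, ∑ j ∈ Ω, τ i j = ∑ i ∈ S, ∑ j ∈ S, τ i j + ∑ i ∈ S, ∑ j ∈ Ω \ S, τ i j := by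
    rw [← Finset.sum_add_distrib]
    exact Finset.sum_congr rfl fun i _ => hΩsplit i
  rw [hτsum, hanti, zero_add] at h1
  linarith

/-- **Stub piece `stub_fluxSingleChart`: FLUX for one chart with a bounded gauge, up to the reference force work
(proved).**  Let the whole cluster be charted by ONE strained stacking `y j = x₀ + G b_{σ j}` (`σ` injective on `Ω`,
`s` Hägg, `G` bi-Lipschitz `4/5, 6/5`) with a bounded gauge `u = x − y`, `‖u j‖ ≤ ν ≤ 1/50` on `Ω`; let the sitewise
landscape bound hold for `(s, G)` at level `E` with corrector `|w| ≤ C_w` (SITEWISE), the strained site series being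
summable, and let `S ⊆ Ω` have occupied image-8-balls.  Then
`E·#S + Σ_{i∈S} ⟪F^Ω_i, u i⟫ − 2ν² Σ_{i∈S} Σ_{j∈Ω∖i} (7281 ‖y i − y j‖⁻¹⁴ + 521 ‖y i − y j‖⁻⁸)
   ≤ Σ_{i∈S} X_i + 3 C_w Σ_{i∈S} Σ_{j∈Ω∖S} ‖y i − y j‖⁻⁶ + 2ν Σ_{i∈S} Σ_{j∈Ω∖S} (‖y i − y j‖⁻¹³ + ‖y i − y j‖⁻⁷)`,
`F^Ω_i = Σ_{j∈Ω∖i} k(y i − y j)` the bond-force sum of the reference TRUNCATED TO `Ω`.  Everything is cut capacity or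
`ν²` except the work `Σ_{i∈S} ⟪F^Ω_i, u i⟫` of the truncation forces (missing sites behind the collar) and residual
forces (mixed words at uniform spacing, off-family cells) of the reference against the gauge: with one chart there
is no gauge change, so this term is the whole remaining content of FLUX in the single-chart case
(`stub_cutSiteExpansion` + `stub_fluxAffineExact` applied to the reference `y`). [folklore] -/
theorem stub_fluxSingleChart :
    ∀ (N : ℕ) (x y u : Fin N → EuclideanSpace ℝ (Fin 3)) (Ω : Finset (Fin N)) (x₀ : EuclideanSpace ℝ (Fin 3))
      (s : ℤ → ℤ) (G : EuclideanSpace ℝ (Fin 3) →L[ℝ] EuclideanSpace ℝ (Fin 3)) (σ : Fin N → ℤ × ℤ × ℤ)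
      (w : ℤ → ℝ) (Cw E ν : ℝ),
      IsHaggSeq s → (∀ v : EuclideanSpace ℝ (Fin 3), 4 / 5 * ‖v‖ ≤ ‖G v‖ ∧ ‖G v‖ ≤ 6 / 5 * ‖v‖) →
      Set.InjOn σ ↑Ω → 0 ≤ ν → ν ≤ 1 / 50 →
      (∀ j : Fin N, y j = x₀ + G (barlowPos 1 (Real.sqrt 6 / 3) s (σ j).1 (σ j).2.1 (σ j).2.2)) →
      (∀ j : Fin N, u j = x j - y j) → (∀ j ∈ Ω, ‖u j‖ ≤ ν) →
      (∀ n : ℤ, |w n| ≤ Cw) →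
      (∀ m : ℤ, E ≤ (1 / 2 : ℝ) * (∑' q : {q : ℤ × ℤ × ℤ // q ≠ (m, 0, 0)},
          lennardJones ‖G (barlowPos 1 (Real.sqrt 6 / 3) s q.1.1 q.1.2.1 q.1.2.2 -
            barlowPos 1 (Real.sqrt 6 / 3) s m 0 0)‖) + w (m - 1) - w m) →
      (∀ q₀ : ℤ × ℤ × ℤ, Summable fun q : {q : ℤ × ℤ × ℤ // q ≠ q₀} =>
          lennardJones ‖G (barlowPos 1 (Real.sqrt 6 / 3) s q.1.1 q.1.2.1 q.1.2.2 -
            barlowPos 1 (Real.sqrt 6 / 3) s q₀.1 q₀.2.1 q₀.2.2)‖) →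
      ∀ S : Finset (Fin N), S ⊆ Ω →
        (∀ i ∈ S, ∀ q : ℤ × ℤ × ℤ, ‖G (barlowPos 1 (Real.sqrt 6 / 3) s q.1 q.2.1 q.2.2 -
            barlowPos 1 (Real.sqrt 6 / 3) s (σ i).1 (σ i).2.1 (σ i).2.2)‖ ≤ 8 → ∃ j ∈ Ω, σ j = q) →
        E * (S.card : ℝ) +
            (∑ i ∈ S, inner ℝ (∑ j ∈ Ω.erase i,
              (-((‖y i - y j‖ ^ 2)⁻¹) ^ 7 + ((‖y i - y j‖ ^ 2)⁻¹) ^ 4) • (y i - y j)) (u i)) -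
            2 * ν ^ 2 * (∑ i ∈ S, ∑ j ∈ Ω.erase i,
              (7281 * ((‖y i - y j‖ ^ 2)⁻¹) ^ 7 + 521 * ((‖y i - y j‖ ^ 2)⁻¹) ^ 4)) ≤
          (∑ i ∈ S, (1 / 2 : ℝ) * (∑ j ∈ Ω.erase i, lennardJones (dist (x i) (x j)))) +
            3 * Cw * (∑ i ∈ S, ∑ j ∈ Ω \ S, ‖y i - y j‖⁻¹ ^ 6) +
            2 * ν * (∑ i ∈ S, ∑ j ∈ Ω \ S, (‖y i - y j‖⁻¹ ^ 13 + ‖y i - y j‖⁻¹ ^ 7)) := by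
  intro N x y u Ω x₀ s G σ w Cw E ν hs hG hσ hν0 hν1 hy hu hub hw hSW hsum S hS hhit
  classical
  have hxyu : ∀ j : Fin N, x j = y j + u j := fun j => by rw [hu j]; abel
  have hyy : ∀ i j : Fin N, y i - y j = G (barlowPos 1 (Real.sqrt 6 / 3) s (σ i).1 (σ i).2.1 (σ i).2.2 -
      barlowPos 1 (Real.sqrt 6 / 3) s (σ j).1 (σ j).2.1 (σ j).2.2) := fun i j => by
    rw [hy i, hy j, map_sub]; abel
  -- reference bonds between distinct cluster sites are at least `(4/5)(√6/3)`
  have h6 : (117 / 50 : ℝ) ≤ Real.sqrt 6 := by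
    rw [show (117 / 50 : ℝ) = Real.sqrt ((117 / 50) ^ 2) by rw [Real.sqrt_sq (by norm_num)]]
    exact Real.sqrt_le_sqrt (by norm_num)
  have hsep : ∀ i ∈ Ω, ∀ j ∈ Ω, i ≠ j → 4 / 5 * (Real.sqrt 6 / 3) ≤ ‖y i - y j‖ := by
    intro i hi j hj hij
    rw [hyy, map_sub]
    have hne0 : σ i ≠ σ j := fun h => hij (hσ hi hj h)
    have hne : ((σ i).1, (σ i).2.1, (σ i).2.2) ≠ ((σ j).1, (σ j).2.1, (σ j).2.2) := by
      rw [show ((σ i).1, (σ i).2.1, (σ i).2.2) = σ i from rfl, show ((σ j).1, (σ j).2.1, (σ j).2.2) = σ j from rfl]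
      exact hne0
    exact norm_image_sub_ge s G (fun p => (hG p).1) hne
  -- domination of the displacements by the reference bonds
  have hdom : ∀ i ∈ S, ∀ j ∈ Ω.erase i, y i - y j ≠ 0 ∧ ‖u i - u j‖ ≤ ‖y i - y j‖ / 4 := by
    intro i hi j hj
    have hjΩ := Finset.mem_of_mem_erase hj
    have hij : i ≠ j := fun h => (Finset.mem_erase.1 hj).1 h.symm
    have hsp := hsep i (hS hi) j hjΩ hij
    have huij : ‖u i - u j‖ ≤ 2 * ν := (norm_sub_le _ _).trans (by linarith [hub i (hS hi), hub j hjΩ])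
    refine ⟨fun h0 => ?_, ?_⟩
    · rw [h0, norm_zero] at hsp; linarith
    · linarith
  -- (A) the summed expansion over the cut; (B) the affine-exact certificate of the reference over the cut
  have hA := stub_cutSiteExpansion N Ω S x y u hS hxyu hdom
  have hB := stub_fluxAffineExact N y Ω x₀ s G σ w Cw E hs hG (fun j _ => hy j) hσ hw hSW hsum S hS hhit
  simp only [dist_eq_norm] at hB ⊢
  -- split `Ω ∖ i = (S ∖ i) ∪ (Ω ∖ S)` for `i ∈ S`
  have hsplit : ∀ i ∈ S, ∀ f : Fin N → EuclideanSpace ℝ (Fin 3),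
      ∑ j ∈ Ω.erase i, f j = ∑ j ∈ S.erase i, f j + ∑ j ∈ Ω \ S, f j := by
    intro i hi f
    have hunion : Ω.erase i = S.erase i ∪ Ω \ S := by
      ext j
      simp only [Finset.mem_erase, Finset.mem_union, Finset.mem_sdiff]
      constructor
      · rintro ⟨hji, hjΩ⟩
        by_cases hjS : j ∈ S
        · exact Or.inl ⟨hji, hjS⟩
        · exact Or.inr ⟨hjΩ, hjS⟩
      · rintro (⟨hji, hjS⟩ | ⟨hjΩ, hjS⟩)
        · exact ⟨hji, hS hjS⟩
        · exact ⟨fun h => hjS (h ▸ hi), hjΩ⟩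
    have hdisj : Disjoint (S.erase i) (Ω \ S) := by
      rw [Finset.disjoint_left]
      intro j hj hj'
      exact (Finset.mem_sdiff.1 hj').2 (Finset.mem_of_mem_erase hj)
    rw [hunion, Finset.sum_union hdisj]
  -- bound on one bond-gradient pairing
  have hkb : ∀ (v z : EuclideanSpace ℝ (Fin 3)) (t : ℝ), 0 ≤ t → ‖z‖ ≤ t →
      |inner ℝ ((-((‖v‖ ^ 2)⁻¹) ^ 7 + ((‖v‖ ^ 2)⁻¹) ^ 4) • v) z| ≤ t * (‖v‖⁻¹ ^ 13 + ‖v‖⁻¹ ^ 7) := by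
    intro v z t ht hz
    calc |inner ℝ ((-((‖v‖ ^ 2)⁻¹) ^ 7 + ((‖v‖ ^ 2)⁻¹) ^ 4) • v) z|
        ≤ ‖(-((‖v‖ ^ 2)⁻¹) ^ 7 + ((‖v‖ ^ 2)⁻¹) ^ 4) • v‖ * ‖z‖ := abs_real_inner_le_norm _ _
      _ ≤ (‖v‖⁻¹ ^ 13 + ‖v‖⁻¹ ^ 7) * t := mul_le_mul (norm_ljBondGrad_le v) hz (norm_nonneg _) (by positivity)
      _ = t * (‖v‖⁻¹ ^ 13 + ‖v‖⁻¹ ^ 7) := by ring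
  -- (1) the work of the `Ω ∖ S` bond forces against `u i`: `≤ ν Σ (…)`
  have hcut1 : ∀ i ∈ S, ∑ j ∈ Ω \ S, inner ℝ ((-((‖y i - y j‖ ^ 2)⁻¹) ^ 7 + ((‖y i - y j‖ ^ 2)⁻¹) ^ 4) •
        (y i - y j)) (u i) ≤ ν * ∑ j ∈ Ω \ S, (‖y i - y j‖⁻¹ ^ 13 + ‖y i - y j‖⁻¹ ^ 7) := by
    intro i hi
    rw [Finset.mul_sum]
    exact Finset.sum_le_sum fun j _ => (le_abs_self _).trans (hkb _ _ ν hν0 (hub i (hS hi)))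
  -- (2) the cut first-order terms: `≥ −2ν Σ (…)`
  have hcut2 : ∀ i ∈ S, -(2 * ν * ∑ j ∈ Ω \ S, (‖y i - y j‖⁻¹ ^ 13 + ‖y i - y j‖⁻¹ ^ 7)) ≤
      ∑ j ∈ Ω \ S, inner ℝ ((-((‖y i - y j‖ ^ 2)⁻¹) ^ 7 + ((‖y i - y j‖ ^ 2)⁻¹) ^ 4) •
        (y i - y j)) (u i - u j) := by
    intro i hi
    rw [Finset.mul_sum, ← Finset.sum_neg_distrib]
    refine Finset.sum_le_sum fun j hj => ?_
    have hjΩ := (Finset.mem_sdiff.1 hj).1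
    have huij : ‖u i - u j‖ ≤ 2 * ν := (norm_sub_le _ _).trans (by linarith [hub i (hS hi), hub j hjΩ])
    exact (abs_le.1 (hkb _ _ (2 * ν) (by linarith) huij)).1
  -- (3) the remainder: `‖u i − u j‖² ≤ 4ν²`
  have hrem : ∀ i ∈ S, (1 / 2 : ℝ) * (∑ j ∈ Ω.erase i, ‖u i - u j‖ ^ 2 *
        (7281 * ((‖y i - y j‖ ^ 2)⁻¹) ^ 7 + 521 * ((‖y i - y j‖ ^ 2)⁻¹) ^ 4)) ≤
      2 * ν ^ 2 * ∑ j ∈ Ω.erase i, (7281 * ((‖y i - y j‖ ^ 2)⁻¹) ^ 7 + 521 * ((‖y i - y j‖ ^ 2)⁻¹) ^ 4) := by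
    intro i hi
    rw [Finset.mul_sum, Finset.mul_sum]
    refine Finset.sum_le_sum fun j hj => ?_
    have hjΩ := Finset.mem_of_mem_erase hj
    have huij : ‖u i - u j‖ ≤ 2 * ν := (norm_sub_le _ _).trans (by linarith [hub i (hS hi), hub j hjΩ])
    have hsq : ‖u i - u j‖ ^ 2 ≤ (2 * ν) ^ 2 := pow_le_pow_left₀ (norm_nonneg _) huij 2
    have hc : (0 : ℝ) ≤ 7281 * ((‖y i - y j‖ ^ 2)⁻¹) ^ 7 + 521 * ((‖y i - y j‖ ^ 2)⁻¹) ^ 4 := by positivity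
    nlinarith [mul_le_mul_of_nonneg_right hsq hc]
  -- summed over `S`
  have hsum1 := Finset.sum_le_sum hcut1
  have hsum2 := Finset.sum_le_sum hcut2
  have hsum3 := Finset.sum_le_sum hrem
  have hK : ∑ i ∈ S, ν * ∑ j ∈ Ω \ S, (‖y i - y j‖⁻¹ ^ 13 + ‖y i - y j‖⁻¹ ^ 7) =
      ν * ∑ i ∈ S, ∑ j ∈ Ω \ S, (‖y i - y j‖⁻¹ ^ 13 + ‖y i - y j‖⁻¹ ^ 7) := by rw [Finset.mul_sum]
  have hK2 : ∑ i ∈ S, -(2 * ν * ∑ j ∈ Ω \ S, (‖y i - y j‖⁻¹ ^ 13 + ‖y i - y j‖⁻¹ ^ 7)) =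
      -(2 * ν * ∑ i ∈ S, ∑ j ∈ Ω \ S, (‖y i - y j‖⁻¹ ^ 13 + ‖y i - y j‖⁻¹ ^ 7)) := by
    rw [Finset.mul_sum, ← Finset.sum_neg_distrib]
  have hR : ∑ i ∈ S, 2 * ν ^ 2 * ∑ j ∈ Ω.erase i, (7281 * ((‖y i - y j‖ ^ 2)⁻¹) ^ 7 + 521 * ((‖y i - y j‖ ^ 2)⁻¹) ^ 4) =
      2 * ν ^ 2 * ∑ i ∈ S, ∑ j ∈ Ω.erase i, (7281 * ((‖y i - y j‖ ^ 2)⁻¹) ^ 7 + 521 * ((‖y i - y j‖ ^ 2)⁻¹) ^ 4) := by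
    rw [Finset.mul_sum]
  -- the work term: `F^S_i = F^Ω_i − Σ_{Ω∖S}`
  have hwork : ∑ i ∈ S, inner ℝ (∑ j ∈ S.erase i, (-((‖y i - y j‖ ^ 2)⁻¹) ^ 7 +
        ((‖y i - y j‖ ^ 2)⁻¹) ^ 4) • (y i - y j)) (u i) =
      (∑ i ∈ S, inner ℝ (∑ j ∈ Ω.erase i, (-((‖y i - y j‖ ^ 2)⁻¹) ^ 7 +
        ((‖y i - y j‖ ^ 2)⁻¹) ^ 4) • (y i - y j)) (u i)) -
        ∑ i ∈ S, ∑ j ∈ Ω \ S, inner ℝ ((-((‖y i - y j‖ ^ 2)⁻¹) ^ 7 +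
          ((‖y i - y j‖ ^ 2)⁻¹) ^ 4) • (y i - y j)) (u i) := by
    rw [← Finset.sum_sub_distrib]
    refine Finset.sum_congr rfl fun i hi => ?_
    rw [hsplit i hi, inner_add_left]
    simp only [sum_inner]
    ring
  rw [hwork] at hA
  linarith [hA, hB, hsum1, hsum2, hsum3, hK, hK2, hR]

end Summit.AtomisticToContinuum.Crystallization.Theorems.NashClassCertificatesNashNearField

end
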